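/-
Copyright (c) 2026 the pub-hodgecm-mathlib formalisation cell (harness21).  Prover seat hodgecm-mathlib-A-p14 (g32), P6 «MOD programme»,
P6a desk F0P6a-plan (g1) ORGAN DEALS #1 (O-α) «HECKE–SERRE CONSTRUCTOR», FILE α2a′ (offer ρ2); 2026-09-01.
-/
import Literature.AlgebraicGeometry.AbelianSchemes.SerreTensorIntegralIdealCover
import Literature.AlgebraicGeometry.AbelianSchemes.SerreTensorTorsionPoints
import HarnessLib

/-!
# The kernel of the cover `c : A ⊗_𝒪 𝔞 ⟶ A` is EXACTLY the `𝔞`-torsion: `(A ⊗ 𝔞)[𝔞] ⊆ Ker c` (coordinates), hence `Ker c = (A ⊗ 𝔞)[𝔞]` on points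
# (B. Conrad, *Gross–Zagier revisited* §7; [MilneCM2006] §7; [RapoportSmithlingZhang2020Diagonal] (4.23))

Topic `AlgebraicGeometry/AbelianSchemes`, namespace `Literature.AlgebraicGeometry.AbelianSchemes.AbelianSchemeOver`.  THEOREMS ONLY (no definition, no named
fact, no `instance`, no notation, no `sorry`; ANY base scheme `S`).  Cell `hodgecm-mathlib` (D-0151), F0/P6 «MOD», sequel to ★ FILE α2a `SerreTensorIntegralIdealCover`
(p846336; `Ker c ⊆ (A ⊗ 𝔞)[𝔞]`) supplying the REVERSE inclusion, so that the roof provers (P6a `RoofΩ` (r2) «`Ker c(Ω) = A_y″[𝔞](Ω)`») read an EQUALITY;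
`--supports stmt-HodgeConjecture-24832`, COUNT-NEUTRAL.  HONEST LABEL: HC_CM is proved only modulo the 2 remaining named inputs (hLiu418 24832, h413 24833) until
rung 0 closes; this file discharges none of them.

## Mathematics

`c = (A ⊗ Q) ≫ (A ⊗_𝒪 𝒪 ≅ A)` for the inclusion functional `Q` of `𝔞 ≅ 𝔟 = E′·𝒪ᵐ` (`QE′ = Q`); the ENTRIES of `Q` lie in `𝔞` (they are the images `Q(E′e_k) ∈ 𝔞`).
On `T`-points a point `t` of `A ⊗ 𝔟` has coordinates `(t_k)` (★ `serreHomEquiv`), the action is coordinatewise (★ `comp_serreAction_i_eq_one_iff`) and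
`t ≫ (A ⊗ Q)` has the single coordinate `∏_k t_k ≫ ι(Q_k)` (★ `serreHomEquiv_serrePresentationHom`, ★ `matrixCompRect`).  Hence if `ι(a) t = 1` for all
`a ∈ 𝔞` then every factor `t_k ≫ ι(Q_k)` is `1` and **`t ≫ c = 1`**: `(A ⊗ 𝔞)[𝔞] ⊆ Ker c` — no invertibility of `𝔞` is needed for this inclusion.  With ★ α2a
(`Ker c ⊆ (A ⊗ 𝔞)[𝔞]` when every `a ∈ 𝔞` is presented by a column `P_a` with `P_a Q = a • E′`) the kernel of the cover is EXACTLY the `𝔞`-torsion on points.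

## Contents

* `comp_serrePresentationHom_one_eq_one_of_forall` (`t ≫ (A ⊗ Q) = 1`), **`comp_serreTranslateInv_eq_one_of_forall_comp_serreAction_i_eq_one`**
  (`(A ⊗ 𝔞)[𝔞] ⊆ Ker c`), **`comp_serreTranslateInv_eq_one_iff_forall_comp_serreAction_i_eq_one`** (`Ker c = (A ⊗ 𝔞)[𝔞]` on `T`-points).

## References
* [Conrad2004GrossZagier] B. Conrad, *Gross–Zagier revisited*, MSRI Publ. 49 (2004), §7 «The Serre tensor construction», Thm. 7.5.
* [MilneCM2006] J. S. Milne, *Complex Multiplication* (2006), §7 «𝔞-multiplications» (Def. 7.19–Rem. 7.23, pp. 58–59).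
* [RapoportSmithlingZhang2020Diagonal] M. Rapoport, B. Smithling, W. Zhang (2020), §4, (4.23) (p. 21).
-/

set_option autoImplicit false

noncomputable section

universe u

open CategoryTheory CategoryTheory.Limits AlgebraicGeometry MonoidalCategory CartesianMonoidalCategory
open scoped MonObj

namespace Literature.AlgebraicGeometry.AbelianSchemes

namespace AbelianSchemeOver

variable {S : Scheme.{u}} {A : AbelianSchemeOver S} {O : Type*} [CommRing O] (act : A.RingAction O) [IsCommMonObj A.X]
  {m : ℕ} (E' : Matrix (Fin m) (Fin m) O) (hE' : E' * E' = E') (Q : Matrix (Fin 1) (Fin m) O)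

/-- **`t ≫ (A ⊗ Q) = 1`** when the entries of `Q` lie in a set `𝔞` of scalars all of which kill `t` (coordinates: the single coordinate of `t ≫ (A ⊗ Q)` is
`∏_k t_k ≫ ι(Q_k)`). [cite: Conrad2004GrossZagier, §7 (Thm. 7.5)] -/
theorem comp_serrePresentationHom_one_eq_one_of_forall (hQ : Q * E' = Q) (𝔞 : Set O) (hQ𝔞 : ∀ j k, Q j k ∈ 𝔞)
    {T : Over S} (t : T ⟶ (serreTensor act E' hE').X) (ht : ∀ a ∈ 𝔞, t ≫ (serreAction act E' hE').i a = 1) :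
    t ≫ serrePresentationHom act E' hE' (1 : Matrix (Fin 1) (Fin 1) O) one_mul_one_fin_one Q = 1 := by
  rw [eq_one_iff_serreHomEquiv]
  intro j
  rw [serreHomEquiv_serrePresentationHom act E' hE' (1 : Matrix (Fin 1) (Fin 1) O) one_mul_one_fin_one Q (by rw [Matrix.one_mul, hQ]) t]
  unfold matrixCompRect
  refine Finset.prod_eq_one fun k _ => ?_
  exact (comp_serreAction_i_eq_one_iff act E' hE' t (Q j k)).1 (ht (Q j k) (hQ𝔞 j k)) k

/-- **`(A ⊗ 𝔞)[𝔞] ⊆ Ker c` on `T`-points**: if the entries of the inclusion functional `Q` lie in `𝔞` and `ι(a) t = 1` for all `a ∈ 𝔞`, then `t ≫ c = 1`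
(`c = (A ⊗ Q) ≫ (A ⊗_𝒪 𝒪 ≅ A)`, ★ `serreTranslateInv`). [cite: Conrad2004GrossZagier, §7 (Thm. 7.5)] [cite: MilneCM2006, §7] -/
theorem comp_serreTranslateInv_eq_one_of_forall_comp_serreAction_i_eq_one (hQ : Q * E' = Q) (𝔞 : Set O) (hQ𝔞 : ∀ j k, Q j k ∈ 𝔞)
    {T : Over S} (t : T ⟶ (serreTensor act E' hE').X) (ht : ∀ a ∈ 𝔞, t ≫ (serreAction act E' hE').i a = 1) :
    t ≫ serreTranslateInv act E' hE' Q = 1 := by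
  haveI := (isMonHom_serreTensorOneIso act).1
  rw [serreTranslateInv_eq, ← Category.assoc, comp_serrePresentationHom_one_eq_one_of_forall act E' hE' Q hQ 𝔞 hQ𝔞 t ht, MonObj.one_comp]

/-- **`Ker c = (A ⊗ 𝔞)[𝔞]` on `T`-points** (both inclusions): with the entries of `Q` in `𝔞` and every `a ∈ 𝔞` presented by a column `P_a` (`E′P_a = P_a`,
`P_a Q = a • E′`), `t ≫ c = 1 ↔ ∀ a ∈ 𝔞, t ≫ ι_{A⊗𝔞}(a) = 1` (★ α2a `forall_comp_serreAction_i_eq_one_of_comp_serreTranslateInv_eq_one` for `→`).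
[cite: Conrad2004GrossZagier, §7 (Thm. 7.5)] [cite: RapoportSmithlingZhang2020Diagonal, §4 (4.23) (p. 21)] -/
theorem comp_serreTranslateInv_eq_one_iff_forall_comp_serreAction_i_eq_one (hQ : Q * E' = Q) (𝔞 : Set O) (hQ𝔞 : ∀ j k, Q j k ∈ 𝔞)
    (h𝔞 : ∀ a ∈ 𝔞, ∃ Pa : Matrix (Fin m) (Fin 1) O, E' * Pa = Pa ∧ Pa * Q = a • E')
    {T : Over S} (t : T ⟶ (serreTensor act E' hE').X) :
    t ≫ serreTranslateInv act E' hE' Q = 1 ↔ ∀ a ∈ 𝔞, t ≫ (serreAction act E' hE').i a = 1 :=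
  ⟨forall_comp_serreAction_i_eq_one_of_comp_serreTranslateInv_eq_one act E' hE' Q hQ 𝔞 h𝔞 t,
    comp_serreTranslateInv_eq_one_of_forall_comp_serreAction_i_eq_one act E' hE' Q hQ 𝔞 hQ𝔞 t⟩

end AbelianSchemeOver

end Literature.AlgebraicGeometry.AbelianSchemes
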